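import Summits.BirchSwinnertonDyer.BirchSwinnertonDyer.Theorems.PrintCFramBottomClassIndexLawFiveLeCuspSeedCoprimeMoebiusEuler
import Mathlib.NumberTheory.LSeries.HurwitzZetaValues
import Mathlib.Analysis.SpecialFunctions.Gaussian.GaussianIntegral
import HarnessLib

set_option autoImplicit false

/-!
# Crux `PrintCFram.BottomClassIndexLawFiveLe` (stmt-BirchSwinnertonDyer-20372), line `eisenstein-resource-bdp-line` (registry v24):
# CUSP GLUE (β) — THE TRANSCENDENTAL-CONSTANT CANCELLATION `Γ(k+½)·(2π)^{−(k+½)}·L(𝟙_{⊥m}, 2k) = π^k · rational`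
# (cell `bsd-print-cfram`, width seat `bsd-line-cfram-p1-w2` g13; THEOREMS ONLY, `--supports` 20372; Mathlib currency;
# BSD is not proved by any of this)

HONEST FRAMING. Elementary special values (no elliptic curve, no modular form, no BSD). In the evaluation of the cusp-`0`
constant of the `m`-cut Cohen–Eisenstein vehicle (conjunct (iii) of the registered stub `stub_cuspCutForm`; crux notes
`Lines/eisenstein-resource-bdp-line-w5g5-cusp-seed.md` §§2–5 and w8 g8's cusp-glue plan, STATUS 2026-08-29T04:17:31Z) the
Abel/Mellin bridge (`CuspSeed.tendsto_sub_mul_LSeries_of_tendsto_rpow_smul_tsum`, (E4)) produces the factor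
`Γ(w)/(2π)^w` at `w = k + ½`, and the residue (E3) carries `π^{−k} · L(𝟙_{⊥m}, 2k)`. This file proves that these
transcendental factors cancel to `π^k` times an explicit RATIONAL number:

* §1 `coprime_prod_primeFactors_iff`, `LSeries_coprime_one_mul_prod_eq`, **`LSeries_coprime_one_eq_riemannZeta_mul_prod`**:
  `L(𝟙_{⊥m}, s) = ζ(s) · ∏_{q ∣ m prime} (1 − q^{−s})` (`Re s > 1`), from w3 g13's one-prime step
  `FamilyMean.LSeries_coprime_mul_one_sub_cpow`;
* §2 `doubleFactorial_two_mul_sub_one_mul`: `(2k−1)‼ · 2^k · k! = (2k)!`; **`Real_Gamma_nat_add_half_eq`**: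
  `Γ(k + ½) = (2k)! · √π / (4^k · k!)`; `two_mul_pi_rpow_nat_add_half`: `(2π)^{k+½} = (2π)^k · √(2π)`;
* §3 **`Gamma_div_rpow_mul_riemannZeta_two_mul`**: `Γ(k+½)/(2π)^{k+½} · ζ(2k) = (−1)^{k+1} · B_{2k}/k! · π^k/(2^{k+1}·√2)` (`k ≥ 1`);
  **`Gamma_div_rpow_mul_LSeries_coprime_two_mul`**: the same times `∏_{q ∣ m}(1 − q^{−2k})` for `L(𝟙_{⊥m}, 2k)`;
  **`Gamma_div_rpow_mul_LSeries_coprime_two_mul_eq_ratCast`**: the algebraic part as ONE rational number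
  `r = (−1)^{k+1} · B_{2k}/k! · ∏_{q ∣ m}(1 − q^{−2k}) ∈ ℚ`: `Γ(k+½)/(2π)^{k+½} · L(𝟙_{⊥m}, 2k) = r · π^k/(2^{k+1}√2)`;
  and the SQUARED form `sq_Gamma_div_rpow_mul_LSeries_coprime_two_mul` (no `√2`): `(…)² = r² · π^{2k}/2^{2k+3}`.

Inputs: Mathlib `riemannZeta_two_mul_nat` (`ζ(2k) = (−1)^{k+1} 2^{2k−1} π^{2k} B_{2k}/(2k)!`), `Real.Gamma_nat_add_half`,
`LSeries_one_eq_riemannZeta`. [folklore]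
-/

-- summit-side namespace `Summit.BirchSwinnertonDyer.BirchSwinnertonDyer.…` (single-conjunct summit, D-0017 layout)
set_option linter.dupNamespace false

namespace Summit.BirchSwinnertonDyer.BirchSwinnertonDyer.Theorems.PrintCFram.CuspGlue

open Filter Topology Complex LSeries Finset Real
open scoped Nat

/-! ### §1. `L(𝟙_{⊥m}, s) = ζ(s) · ∏_{q ∣ m} (1 − q^{−s})` -/

/-- For `n, m ≠ 0`: `n ⊥ ∏_{q ∣ m prime} q ⟺ n ⊥ m` (coprimality only sees the prime support). [folklore] -/
theorem coprime_prod_primeFactors_iff {n m : ℕ} (hn : n ≠ 0) (hm : m ≠ 0) :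
    n.Coprime (∏ q ∈ m.primeFactors, q) ↔ n.Coprime m := by
  have hrad : (∏ q ∈ m.primeFactors, q) ≠ 0 :=
    Finset.prod_ne_zero_iff.mpr fun q hq ↦ (Nat.prime_of_mem_primeFactors hq).ne_zero
  rw [← Nat.disjoint_primeFactors hn hrad, ← Nat.disjoint_primeFactors hn hm,
    Nat.primeFactors_prod fun q hq ↦ Nat.prime_of_mem_primeFactors hq]

/-- `L(𝟙_{⊥M}, s) · ∏_{ℓ ∈ T}(1 − ℓ^{−s}) = L(𝟙_{⊥(M·∏_{ℓ∈T} ℓ)}, s)` for a finite set `T` of primes not dividing `M`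
(`Re s > 1`); induction on w3 g13's one-prime step `FamilyMean.LSeries_coprime_mul_one_sub_cpow`. [folklore] -/
theorem LSeries_coprime_one_mul_prod_eq {M : ℕ} (T : Finset ℕ) (hT : ∀ ℓ ∈ T, ℓ.Prime ∧ ¬ ℓ ∣ M)
    {s : ℂ} (hs : 1 < s.re) :
    LSeries (fun N ↦ if N.Coprime M then (1 : ℂ) else 0) s * ∏ ℓ ∈ T, (1 - (ℓ : ℂ) ^ (-s)) =
      LSeries (fun N ↦ if N.Coprime (M * ∏ ℓ ∈ T, ℓ) then (1 : ℂ) else 0) s := by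
  induction T using Finset.induction_on with
  | empty => simp
  | insert a T haT ih =>
    have hT' : ∀ ℓ ∈ T, ℓ.Prime ∧ ¬ ℓ ∣ M := fun ℓ hℓ ↦ hT ℓ (mem_insert_of_mem hℓ)
    obtain ⟨ha, haM⟩ := hT a (mem_insert_self a T)
    have haM' : ¬ a ∣ M * ∏ ℓ ∈ T, ℓ := by
      intro h
      rcases (Nat.Prime.dvd_mul ha).mp h with h | h
      · exact haM h
      · obtain ⟨ℓ, hℓT, hℓ⟩ := (Prime.dvd_finsetProd_iff ha.prime _).mp h
        have := (Nat.prime_dvd_prime_iff_eq ha (hT' ℓ hℓT).1).mp hℓ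
        exact haT (this ▸ hℓT)
    rw [prod_insert haT, prod_insert haT, mul_comm (1 - (a : ℂ) ^ (-s)) _, ← mul_assoc, ih hT',
      FamilyMean.LSeries_coprime_mul_one_sub_cpow ha haM' hs,
      show M * (a * ∏ ℓ ∈ T, ℓ) = M * (∏ ℓ ∈ T, ℓ) * a by ring]

/-- **`L(𝟙_{⊥m}, s) = ζ(s) · ∏_{q ∣ m prime}(1 − q^{−s})`** for `m ≠ 0` and `Re s > 1`: the Dirichlet series of the principal
character mod `m` is the Riemann zeta function with the Euler factors at the primes of `m` removed. [folklore] -/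
theorem LSeries_coprime_one_eq_riemannZeta_mul_prod {m : ℕ} (hm : m ≠ 0) {s : ℂ} (hs : 1 < s.re) :
    LSeries (fun N ↦ if N.Coprime m then (1 : ℂ) else 0) s =
      riemannZeta s * ∏ q ∈ m.primeFactors, (1 - (q : ℂ) ^ (-s)) := by
  have h := LSeries_coprime_one_mul_prod_eq (M := 1) m.primeFactors
    (fun ℓ hℓ ↦ ⟨Nat.prime_of_mem_primeFactors hℓ, (Nat.prime_of_mem_primeFactors hℓ).not_dvd_one⟩) hs
  have h1 : LSeries (fun N ↦ if N.Coprime 1 then (1 : ℂ) else 0) s = riemannZeta s := by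
    rw [← LSeries_one_eq_riemannZeta hs]
    exact LSeries_congr (fun {n} _ ↦ by simp) s
  have h2 : LSeries (fun N ↦ if N.Coprime (1 * ∏ ℓ ∈ m.primeFactors, ℓ) then (1 : ℂ) else 0) s =
      LSeries (fun N ↦ if N.Coprime m then (1 : ℂ) else 0) s := by
    refine LSeries_congr (fun {n} hn ↦ ?_) s
    rw [one_mul]
    exact if_congr (coprime_prod_primeFactors_iff hn hm) rfl rfl
  rw [← h2, ← h, h1]

/-! ### §2. `Γ(k + ½)` and `(2π)^{k+½}` -/

/-- `(2k−1)‼ · (2^k · k!) = (2k)!` (the odd and even double factorials). [folklore] -/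
theorem doubleFactorial_two_mul_sub_one_mul (k : ℕ) : (2 * k - 1)‼ * (2 ^ k * k !) = (2 * k)! := by
  rcases Nat.eq_zero_or_pos k with rfl | hk
  · simp
  · obtain ⟨j, rfl⟩ := Nat.exists_eq_add_one_of_ne_zero hk.ne'
    rw [← Nat.doubleFactorial_two_mul, show 2 * (j + 1) = 2 * j + 1 + 1 by ring,
      Nat.factorial_eq_mul_doubleFactorial, show 2 * j + 1 + 1 - 1 = 2 * j + 1 by omega, mul_comm]

/-- **`Γ(k + ½) = (2k)! · √π / (4^k · k!)`** (Mathlib's `Real.Gamma_nat_add_half` with `(2k−1)‼ = (2k)!/(2^k k!)`). [folklore] -/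
theorem Real_Gamma_nat_add_half_eq (k : ℕ) :
    Real.Gamma (k + 1 / 2) = (2 * k)! * √π / (4 ^ k * k !) := by
  rw [Real.Gamma_nat_add_half k]
  have h := doubleFactorial_two_mul_sub_one_mul k
  have h' : ((2 * k - 1)‼ : ℝ) = (2 * k)! / (2 ^ k * k !) := by
    rw [eq_div_iff (by positivity)]
    exact_mod_cast h
  rw [h', show (4 : ℝ) ^ k = 2 ^ k * 2 ^ k by rw [← mul_pow]; norm_num]
  field_simp

/-- `(2π)^{k+½} = (2π)^k · √(2π)` (real powers). [folklore] -/
theorem two_mul_pi_rpow_nat_add_half (k : ℕ) :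
    (2 * π) ^ ((k : ℝ) + 1 / 2) = (2 * π) ^ k * √(2 * π) := by
  rw [Real.rpow_add (by positivity), Real.rpow_natCast, Real.sqrt_eq_rpow]

/-- `√(2π) = √2 · √π`. [folklore] -/
theorem sqrt_two_mul_pi : √(2 * π) = √2 * √π := Real.sqrt_mul (by norm_num) π

/-! ### §3. The cancellation -/

/-- **`Γ(k+½)/(2π)^{k+½} · ζ(2k) = (−1)^{k+1} · B_{2k}/k! · π^k/(2^{k+1}·√2)`** for `k ≥ 1`: Euler's `ζ(2k)` against the
half-integral Gamma value — every power of `π` but `π^k` cancels, and `(2k)!` cancels outright. [folklore] -/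
theorem Gamma_div_rpow_mul_riemannZeta_two_mul {k : ℕ} (hk : k ≠ 0) :
    ((Real.Gamma (k + 1 / 2) / (2 * π) ^ ((k : ℝ) + 1 / 2) : ℝ) : ℂ) * riemannZeta (2 * k) =
      (-1) ^ (k + 1) * (bernoulli (2 * k) : ℂ) / (k ! : ℂ) * ((π : ℂ) ^ k / (2 ^ (k + 1) * (√2 : ℂ))) := by
  rw [riemannZeta_two_mul_nat hk, Real_Gamma_nat_add_half_eq, two_mul_pi_rpow_nat_add_half, sqrt_two_mul_pi]
  have hπ : (√π : ℂ) ≠ 0 := by exact_mod_cast (Real.sqrt_pos.mpr Real.pi_pos).ne'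
  have h2 : (√2 : ℂ) ≠ 0 := by exact_mod_cast (Real.sqrt_pos.mpr (by norm_num : (0:ℝ) < 2)).ne'
  have hfac : ((2 * k)! : ℂ) ≠ 0 := by exact_mod_cast (Nat.factorial_pos _).ne'
  have hkfac : (k ! : ℂ) ≠ 0 := by exact_mod_cast (Nat.factorial_pos _).ne'
  have hπ' : (π : ℂ) ≠ 0 := by exact_mod_cast Real.pi_pos.ne'
  have hpow : (2 : ℂ) ^ (2 * k - 1) * 2 = 2 ^ (2 * k) := by
    rw [← pow_succ, show 2 * k - 1 + 1 = 2 * k by omega]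
  push_cast
  field_simp
  rw [show (4 : ℂ) ^ k = 2 ^ (2 * k) by rw [pow_mul]; norm_num, ← hpow]
  ring

/-- **`Γ(k+½)/(2π)^{k+½} · L(𝟙_{⊥m}, 2k) = (−1)^{k+1} · B_{2k}/k! · π^k/(2^{k+1}√2) · ∏_{q ∣ m}(1 − q^{−2k})`** (`k, m ≥ 1`),
the Euler factors as inverses of natural powers. [folklore] -/
theorem Gamma_div_rpow_mul_LSeries_coprime_two_mul {k m : ℕ} (hk : k ≠ 0) (hm : m ≠ 0) :
    ((Real.Gamma (k + 1 / 2) / (2 * π) ^ ((k : ℝ) + 1 / 2) : ℝ) : ℂ) *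
        LSeries (fun N ↦ if N.Coprime m then (1 : ℂ) else 0) (2 * k) =
      (-1) ^ (k + 1) * (bernoulli (2 * k) : ℂ) / (k ! : ℂ) * ((π : ℂ) ^ k / (2 ^ (k + 1) * (√2 : ℂ))) *
        ∏ q ∈ m.primeFactors, (1 - ((q : ℂ) ^ (2 * k))⁻¹) := by
  have hs : 1 < (2 * (k : ℂ)).re := by
    simp only [mul_re, re_ofNat, natCast_re, im_ofNat, natCast_im, mul_zero, sub_zero]
    have : (1 : ℝ) ≤ k := by exact_mod_cast Nat.one_le_iff_ne_zero.mpr hk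
    linarith
  rw [LSeries_coprime_one_eq_riemannZeta_mul_prod hm hs, ← mul_assoc, Gamma_div_rpow_mul_riemannZeta_two_mul hk]
  congr 1
  refine Finset.prod_congr rfl fun q _ ↦ ?_
  rw [cpow_neg, show (2 * (k : ℂ)) = ((2 * k : ℕ) : ℂ) by push_cast; ring, cpow_natCast]

/-- **The algebraic part as ONE rational number.** With `r := (−1)^{k+1} · B_{2k}/k! · ∏_{q ∣ m}(1 − (q^{2k})⁻¹) ∈ ℚ`:
`Γ(k+½)/(2π)^{k+½} · L(𝟙_{⊥m}, 2k) = r · π^k/(2^{k+1}√2)` (`k, m ≥ 1`). [folklore] -/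
theorem Gamma_div_rpow_mul_LSeries_coprime_two_mul_eq_ratCast {k m : ℕ} (hk : k ≠ 0) (hm : m ≠ 0) :
    ((Real.Gamma (k + 1 / 2) / (2 * π) ^ ((k : ℝ) + 1 / 2) : ℝ) : ℂ) *
        LSeries (fun N ↦ if N.Coprime m then (1 : ℂ) else 0) (2 * k) =
      (((-1) ^ (k + 1) * bernoulli (2 * k) / k ! * ∏ q ∈ m.primeFactors, (1 - ((q : ℚ) ^ (2 * k))⁻¹) : ℚ) : ℂ) *
        ((π : ℂ) ^ k / (2 ^ (k + 1) * (√2 : ℂ))) := by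
  rw [Gamma_div_rpow_mul_LSeries_coprime_two_mul hk hm]
  push_cast
  ring

/-- **The squared form (no square roots).** With `r` as above:
`(Γ(k+½)/(2π)^{k+½} · L(𝟙_{⊥m}, 2k))² = r² · π^{2k}/2^{2k+3}` (`k, m ≥ 1`). [folklore] -/
theorem sq_Gamma_div_rpow_mul_LSeries_coprime_two_mul {k m : ℕ} (hk : k ≠ 0) (hm : m ≠ 0) :
    (((Real.Gamma (k + 1 / 2) / (2 * π) ^ ((k : ℝ) + 1 / 2) : ℝ) : ℂ) *
        LSeries (fun N ↦ if N.Coprime m then (1 : ℂ) else 0) (2 * k)) ^ 2 =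
      ((((-1) ^ (k + 1) * bernoulli (2 * k) / k ! * ∏ q ∈ m.primeFactors, (1 - ((q : ℚ) ^ (2 * k))⁻¹)) ^ 2 /
          2 ^ (2 * k + 3) : ℚ) : ℂ) * (π : ℂ) ^ (2 * k) := by
  rw [Gamma_div_rpow_mul_LSeries_coprime_two_mul_eq_ratCast hk hm]
  have h2 : ((√2 : ℂ)) ^ 2 = 2 := by
    rw [← Complex.ofReal_pow, Real.sq_sqrt (by norm_num : (0:ℝ) ≤ 2)]
    norm_num
  have h2' : (√2 : ℂ) ≠ 0 := by exact_mod_cast (Real.sqrt_pos.mpr (by norm_num : (0:ℝ) < 2)).ne'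
  push_cast
  field_simp
  rw [h2]
  ring

end Summit.BirchSwinnertonDyer.BirchSwinnertonDyer.Theorems.PrintCFram.CuspGlue
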